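import Summits.BirchSwinnertonDyer.BirchSwinnertonDyer.Theorems.AlignedTransportAtTwoMainConjectureOfRankZeroBSDAtTwoTwinValueAlgebra
import HarnessLib

/-!
# Route `AlignedTransportAtTwo`, crux C2 `MainConjectureOfRankZeroBSDAtTwo` (stmt-BirchSwinnertonDyer-22298):
# THE TWIN-VALUE DICHOTOMY in `Λ = ℤ₂⟦T⟧` — for an `ι`-stable `F` vanishing at neither `ι`-fixed point `T = 0`, `T = −2`:
# EITHER `ord₂ F(0) = ord₂ F(−2)`, OR `μ(F) + 2 ≤` both; hence `{ord₂ F(0), ord₂ F(−2)} ∋ 2` with the two orders distinct ⟹ `μ(F) = 0`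

HONEST FRAMING (cell `bsd-f1-sign2`, WIDTH-5 attached prover seat `bsd-line-att-p5` gen 49 on line `birth` of the lead
`bsd-line-att-p2`; `--supports` stmt-BirchSwinnertonDyer-22298, closes nothing; BSD is NOT proved by any of this; the crux
C2, its verdict «blocked-on `Rank1Residual.GreenbergMuConjectureIrreducible`» and every registered stub are untouched).
THEOREMS ONLY — no `def`, no instance, no named fact, no `sorry`. Pure commutative algebra of `Λ = ℤ₂⟦T⟧` (sequel of
`…TwinValueAlgebra`, whose §1–§2 supply the evaluation-at-`−2` bookkeeping, the `ι`-stability transfer and the parity /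
mod-`4` alternative at `ι`-fixed primes); nothing about any curve is asserted here.

PROOF SHAPE (`twinValue_dichotomy`, induction on `ord₂ F(0)` over the prime factorisation in the UFD `Λ`): a unit has both
orders `0`; if `2 ∣ F` then `F = 2G` with `(G)` `ι`-stable and both orders drop by `1`, `μ` by `1`; otherwise take an
irreducible `π ∣ F` (`μ(π) = 0`, `π ∤ T`, `π ∤ T+2`): if `ιπ ~ π` the mod-`4` alternative gives `ord₂ π(0) = ord₂ π(−2) = 1`
(recurse on the `ι`-stable cofactor) or both `≥ 2` (done, as `μ(G) ≤ ord₂ G(0), ord₂ G(−2)`); if `ιπ ≁ π` then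
`π·ιπ ∣ F` with `(ιπ)(0) = π(0)`, `(ιπ)(−2) = π(−2)`, so both orders of `F` are `≥ 2 + μ` (done). Corollaries:
`mu_add_two_le_of_ne` (**`a ≠ b ⟹ μ + 2 ≤ min(a,b)`**), ★★★ `mu_eq_zero_of_two_eq_of_ne`,
`mu_eq_zero_of_valuation_constantCoeff_eq_two` (**`ord₂ F(0) = 2 < ord₂ F(−2) ⟹ μ(F) = 0`**, the weight-`2` door),
`mu_eq_zero_of_valuation_evalAt_eq_two` (**`ord₂ F(−2) = 2 < ord₂ F(0) ⟹ μ(F) = 0`**, the weight-`4` door).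

References: R. Greenberg, LNM 1716 (1999) Thm. 1.14, §4 p. 107 [GreenbergLNM1716]; B. Mazur, J. Tate, J. Teitelbaum,
Invent. Math. 84 (1986) Ch. I §17 [MazurTateTeitelbaum1986Invent]; L. Washington, GTM 83, §7.1, §13.2 [Washington1997].
-/

set_option linter.dupNamespace false
set_option autoImplicit false

noncomputable section

open scoped Classical

namespace Summit.BirchSwinnertonDyer.BirchSwinnertonDyer.Theorems.AlignedTransportAtTwoTwinValueAlgebra

open PowerSeries Literature.NumberTheory.EllipticCurves Literature.NumberTheory.EllipticCurves.IwasawaAlgebra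
  Summit.BirchSwinnertonDyer.Rank1Residual.X1.MuLambda Summit.BirchSwinnertonDyer.Rank1Residual.X1.ParitySqueeze
  Summit.BirchSwinnertonDyer.Rank1Residual.Supersingular Summit.BirchSwinnertonDyer.Rank1Residual.Supersingular.BlindLever
  Summit.BirchSwinnertonDyer.BirchSwinnertonDyer.Theorems

/-! ## §3 The twin-value dichotomy -/

section Dichotomy

/-- **THE TWIN-VALUE DICHOTOMY.** Let `F ∈ Λ = ℤ₂⟦T⟧` be non-zero with `ι`-stable ideal (`ιF = u·F` for a unit `u`),
`F(0) ≠ 0` and `F(−2) ≠ 0`. Then EITHER `ord₂ F(0) = ord₂ F(−2)`, OR `μ(F) + 2 ≤ ord₂ F(0)` and `μ(F) + 2 ≤ ord₂ F(−2)`.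
(Induction on `ord₂ F(0)` over the prime factorisation of `F` in the UFD `Λ`: the prime `2`, `ι`-moved pairs
`{π, ιπ}`, `ι`-fixed primes with their mod-`4` alternative.) [cite: GreenbergLNM1716, Thm. 1.14 and §4 p. 107]
[cite: MazurTateTeitelbaum1986Invent, Ch. I §17] [cite: Washington1997, §7.1, §13.2] -/
theorem twinValue_dichotomy : ∀ (n : ℕ) (F : IwasawaAlgebra 2), F ≠ 0 → (constantCoeff F).valuation ≤ n →
    (∃ u : (IwasawaAlgebra 2)ˣ, invol 2 F = u * F) → constantCoeff F ≠ 0 → evalAt (-2 : ℤ_[2]) F ≠ 0 →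
    (constantCoeff F).valuation = (evalAt (-2 : ℤ_[2]) F).valuation ∨
      (mu F + 2 ≤ (constantCoeff F).valuation ∧ mu F + 2 ≤ (evalAt (-2 : ℤ_[2]) F).valuation) := by
  intro n
  induction n with
  | zero =>
    intro F hF0 hle _ h0 h2
    left
    have ha : (constantCoeff F).valuation = 0 := Nat.le_zero.mp hle
    -- `F(0)` is a unit, so `F` is a unit, so `F(−2)` is a unit
    have hu0 : IsUnit (constantCoeff F) := by
      by_contra hnu
      have := one_le_valuation_of_not_isUnit h0 hnu
      omega
    have hFu : IsUnit F := isUnit_iff_constantCoeff.mpr hu0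
    have hev : IsUnit (evalAt (-2 : ℤ_[2]) F) := (isUnit_evalAt_iff norm_neg_two_lt_one F).mpr hFu
    have hb : (evalAt (-2 : ℤ_[2]) F).valuation = 0 := by
      have h1 : ‖evalAt (-2 : ℤ_[2]) F‖ = 1 := PadicInt.isUnit_iff.mp hev
      have h2' := PadicInt.norm_eq_zpow_neg_valuation h2
      rw [h1] at h2'
      have : (-((evalAt (-2 : ℤ_[2]) F).valuation : ℤ)) = 0 := by
        have h3 : (2 : ℝ) ^ (-((evalAt (-2 : ℤ_[2]) F).valuation : ℤ)) = (2 : ℝ) ^ (0 : ℤ) := by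
          rw [zpow_zero]; exact_mod_cast h2'.symm
        exact zpow_right_injective₀ (by norm_num) (by norm_num) h3
      omega
    rw [ha, hb]
  | succ n ih =>
    intro F hF0 hle hι h0 h2
    by_cases hFu : IsUnit F
    · -- units: both orders vanish
      left
      have ha : (constantCoeff F).valuation = 0 := by
        have h1 : ‖constantCoeff F‖ = 1 := PadicInt.isUnit_iff.mp (isUnit_iff_constantCoeff.mp hFu)
        have h0' := PadicInt.norm_eq_zpow_neg_valuation h0
        rw [h1] at h0'
        have h3 : (2 : ℝ) ^ (-((constantCoeff F).valuation : ℤ)) = (2 : ℝ) ^ (0 : ℤ) := by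
          rw [zpow_zero]; exact_mod_cast h0'.symm
        have := zpow_right_injective₀ (by norm_num) (by norm_num) h3
        omega
      have hb : (evalAt (-2 : ℤ_[2]) F).valuation = 0 := by
        have h1 : ‖evalAt (-2 : ℤ_[2]) F‖ = 1 :=
          PadicInt.isUnit_iff.mp ((isUnit_evalAt_iff norm_neg_two_lt_one F).mpr hFu)
        have h2' := PadicInt.norm_eq_zpow_neg_valuation h2
        rw [h1] at h2'
        have h3 : (2 : ℝ) ^ (-((evalAt (-2 : ℤ_[2]) F).valuation : ℤ)) = (2 : ℝ) ^ (0 : ℤ) := by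
          rw [zpow_zero]; exact_mod_cast h2'.symm
        have := zpow_right_injective₀ (by norm_num) (by norm_num) h3
        omega
      rw [ha, hb]
    -- an irreducible factor `π ∣ F`, `F = π * G`
    obtain ⟨π, hπirr, hπF⟩ := WfDvdMonoid.exists_irreducible_factor hFu hF0
    have hπ : Prime π := hπirr.prime
    have hπ0 : π ≠ 0 := hπ.ne_zero
    obtain ⟨G, hFG⟩ := hπF
    have hG0 : G ≠ 0 := fun h ↦ hF0 (by rw [hFG, h, mul_zero])
    -- values multiply
    have hcc : constantCoeff F = constantCoeff π * constantCoeff G := by rw [hFG, map_mul]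
    have hev : evalAt (-2 : ℤ_[2]) F = evalAt (-2 : ℤ_[2]) π * evalAt (-2 : ℤ_[2]) G := by
      rw [hFG, evalAt_mul norm_neg_two_lt_one]
    have hπc0 : constantCoeff π ≠ 0 := fun h ↦ h0 (by rw [hcc, h, zero_mul])
    have hGc0 : constantCoeff G ≠ 0 := fun h ↦ h0 (by rw [hcc, h, mul_zero])
    have hπe0 : evalAt (-2 : ℤ_[2]) π ≠ 0 := fun h ↦ h2 (by rw [hev, h, zero_mul])
    have hGe0 : evalAt (-2 : ℤ_[2]) G ≠ 0 := fun h ↦ h2 (by rw [hev, h, mul_zero])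
    have haF : (constantCoeff F).valuation = (constantCoeff π).valuation + (constantCoeff G).valuation := by
      rw [hcc, PadicInt.valuation_mul hπc0 hGc0]
    have hbF : (evalAt (-2 : ℤ_[2]) F).valuation =
        (evalAt (-2 : ℤ_[2]) π).valuation + (evalAt (-2 : ℤ_[2]) G).valuation := by
      rw [hev, PadicInt.valuation_mul hπe0 hGe0]
    have haπ : 1 ≤ (constantCoeff π).valuation := one_le_valuation_constantCoeff_of_not_isUnit hπirr.not_isUnit hπc0
    have hbπ : 1 ≤ (evalAt (-2 : ℤ_[2]) π).valuation := one_le_valuation_evalAt_of_not_isUnit hπirr.not_isUnit hπe0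
    have hμF : mu F = mu π + mu G := by rw [hFG, mu_mul hπ0 hG0]
    have hμG : mu G ≤ (constantCoeff G).valuation := mu_le_valuation_constantCoeff hG0 hGc0
    have hμG' : mu G ≤ (evalAt (-2 : ℤ_[2]) G).valuation := mu_le_valuation_evalAt hG0 hGe0
    -- `T ∤` and `T + 2 ∤`: `π` divides neither `T` nor `T + 2`
    have hπX : ¬ π ∣ PowerSeries.X := by
      intro h
      have hassoc : Associated π (PowerSeries.X : IwasawaAlgebra 2) := hπirr.associated_of_dvd X_prime.irreducible h
      have hXF : (PowerSeries.X : IwasawaAlgebra 2) ∣ F := hassoc.symm.dvd.trans ⟨G, hFG⟩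
      exact h0 (X_dvd_iff.mp hXF)
    have hπX2 : ¬ π ∣ (PowerSeries.X + PowerSeries.C (2 : ℤ_[2])) := by
      intro h
      have hassoc : Associated π (PowerSeries.X + PowerSeries.C (2 : ℤ_[2]) : IwasawaAlgebra 2) :=
        hπirr.associated_of_dvd prime_X_add_C_two.irreducible h
      obtain ⟨H, hH⟩ := hassoc.symm.dvd.trans ⟨G, hFG⟩
      apply h2
      rw [hH, evalAt_mul norm_neg_two_lt_one, evalAt_neg_two_X_add_C_two, zero_mul]
    -- `π ≁ 2` would follow from `2 ∤ F`; we split on `2 ∣ F` FIRST (replacing `π` by `2` in that case)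
    by_cases h2F : (PowerSeries.C (2 : ℤ_[2]) : IwasawaAlgebra 2) ∣ F
    · -- CASE `2 ∣ F`: `F = 2·G'`, the prime `2` contributes `(1,1)`; induct on `G'`
      clear hcc hev hπc0 hGc0 hπe0 hGe0 haF hbF haπ hbπ hμF hμG hμG' hπX hπX2 hFG hG0 G hπ0 hπ hπirr π
      obtain ⟨G, hFG⟩ := h2F
      have hG0 : G ≠ 0 := fun h ↦ hF0 (by rw [hFG, h, mul_zero])
      have hcc : constantCoeff F = 2 * constantCoeff G := by rw [hFG, map_mul, constantCoeff_C]
      have hev : evalAt (-2 : ℤ_[2]) F = 2 * evalAt (-2 : ℤ_[2]) G := by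
        rw [hFG, evalAt_mul norm_neg_two_lt_one, evalAt_C]
      have hGc0 : constantCoeff G ≠ 0 := fun h ↦ h0 (by rw [hcc, h, mul_zero])
      have hGe0 : evalAt (-2 : ℤ_[2]) G ≠ 0 := fun h ↦ h2 (by rw [hev, h, mul_zero])
      have haF : (constantCoeff F).valuation = 1 + (constantCoeff G).valuation := by
        rw [hcc, valuation_two_mul hGc0]
      have hbF : (evalAt (-2 : ℤ_[2]) F).valuation = 1 + (evalAt (-2 : ℤ_[2]) G).valuation := by
        rw [hev, valuation_two_mul hGe0]
      have hμF : mu F = 1 + mu G := by rw [hFG, mu_mul prime_C_two.ne_zero hG0, mu_C_two]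
      have hιG : ∃ u : (IwasawaAlgebra 2)ˣ, invol 2 G = u * G :=
        iotaStable_of_mul_left hι hFG prime_C_two.ne_zero ⟨1, by rw [invol_C, Units.val_one, one_mul]⟩
      rcases ih G hG0 (by omega) hιG hGc0 hGe0 with h | ⟨h₁, h₂⟩
      · left; omega
      · right; constructor <;> omega
    -- now `2 ∤ F`, so `π ≁ 2` and `μ(π) = 0`
    have hπ2 : ¬ Associated π (PowerSeries.C (2 : ℤ_[2])) := fun h ↦ h2F (h.symm.dvd.trans ⟨G, hFG⟩)
    have hμπ : mu π = 0 := mu_eq_zero_of_irreducible_of_not_associated hπirr hπ2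
    by_cases hfix : Associated (invol 2 π) π
    · -- CASE `π` `ι`-FIXED: `π(−2) ≡ π(0) (mod 4)`; `(G)` is `ι`-stable
      have h4 := four_dvd_of_fixed_prime hπ hμπ hfix hπX hπX2
      have hiff := two_le_valuation_iff_of_four_dvd_sub hπe0 hπc0 h4
      have hιG : ∃ u : (IwasawaAlgebra 2)ˣ, invol 2 G = u * G := by
        obtain ⟨w, hw⟩ := hfix
        -- `ιπ * w = π`, so `ιπ = w⁻¹ * π`
        refine iotaStable_of_mul_left hι hFG hπ0 ⟨w⁻¹, ?_⟩
        rw [(Units.eq_mul_inv_iff_mul_eq w).mpr hw, mul_comm]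
      by_cases ha1 : (constantCoeff π).valuation = 1
      · -- `π` contributes `(1,1)`: induct on `G`
        have hb1 : (evalAt (-2 : ℤ_[2]) π).valuation = 1 := by
          by_contra hb
          have hb2 : 2 ≤ (evalAt (-2 : ℤ_[2]) π).valuation := by omega
          have := hiff.mp hb2
          omega
        rcases ih G hG0 (by omega) hιG hGc0 hGe0 with h | ⟨h₁, h₂⟩
        · left; omega
        · right
          rw [hμF, hμπ, zero_add]
          constructor <;> omega
      · -- `π` contributes `(≥ 2, ≥ 2)`: done directly
        have ha2 : 2 ≤ (constantCoeff π).valuation := by omega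
        have hb2 : 2 ≤ (evalAt (-2 : ℤ_[2]) π).valuation := hiff.mpr ha2
        right
        rw [hμF, hμπ, zero_add]
        constructor <;> omega
    · -- CASE `π` `ι`-MOVED: `π · ιπ ∣ F`, the pair contributes `(≥ 2, ≥ 2)`
      have hιπ : Prime (invol 2 π) := prime_invol hπ
      have hιπF : invol 2 π ∣ F := invol_dvd_of_dvd hι ⟨G, hFG⟩
      have hιπG : invol 2 π ∣ G := by
        rw [hFG] at hιπF
        rcases hιπ.dvd_or_dvd hιπF with h | h
        · exact absurd (hιπ.irreducible.associated_of_dvd hπirr h) hfix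
        · exact h
      obtain ⟨H, hGH⟩ := hιπG
      have hH0 : H ≠ 0 := fun h ↦ hG0 (by rw [hGH, h, mul_zero])
      have hιπ0 : invol 2 π ≠ 0 := hιπ.ne_zero
      -- values of the partner
      have hcι : constantCoeff (invol 2 π) = constantCoeff π := constantCoeff_invol 2 π
      have heι : evalAt (-2 : ℤ_[2]) (invol 2 π) = evalAt (-2 : ℤ_[2]) π := evalAt_neg_two_invol π
      have hccG : constantCoeff G = constantCoeff (invol 2 π) * constantCoeff H := by rw [hGH, map_mul]
      have hevG : evalAt (-2 : ℤ_[2]) G = evalAt (-2 : ℤ_[2]) (invol 2 π) * evalAt (-2 : ℤ_[2]) H := by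
        rw [hGH, evalAt_mul norm_neg_two_lt_one]
      have hHc0 : constantCoeff H ≠ 0 := fun h ↦ hGc0 (by rw [hccG, h, mul_zero])
      have hHe0 : evalAt (-2 : ℤ_[2]) H ≠ 0 := fun h ↦ hGe0 (by rw [hevG, h, mul_zero])
      have haG : (constantCoeff G).valuation = (constantCoeff π).valuation + (constantCoeff H).valuation := by
        rw [hccG, hcι, PadicInt.valuation_mul hπc0 hHc0]
      have hbG : (evalAt (-2 : ℤ_[2]) G).valuation =
          (evalAt (-2 : ℤ_[2]) π).valuation + (evalAt (-2 : ℤ_[2]) H).valuation := by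
        rw [hevG, heι, PadicInt.valuation_mul hπe0 hHe0]
      have hμιπ : mu (invol 2 π) = 0 := by
        refine mu_eq_zero_of_irreducible_of_not_associated hιπ.irreducible fun h ↦ hπ2 ?_
        -- `ιπ ~ 2 ⟹ π ~ ι2 = 2`
        obtain ⟨w, hw⟩ := h
        refine ⟨(Units.map (invol 2 : IwasawaAlgebra 2 →ₐ[ℤ_[2]] IwasawaAlgebra 2).toMonoidHom w), ?_⟩
        have e := congrArg (invol 2) hw
        rw [map_mul, invol_invol, invol_C] at e
        exact e
      have hμG : mu G = mu H := by rw [hGH, mu_mul hιπ0 hH0, hμιπ, zero_add]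
      have hμH : mu H ≤ (constantCoeff H).valuation := mu_le_valuation_constantCoeff hH0 hHc0
      have hμH' : mu H ≤ (evalAt (-2 : ℤ_[2]) H).valuation := mu_le_valuation_evalAt hH0 hHe0
      right
      rw [hμF, hμπ, zero_add, hμG]
      constructor <;> omega

/-- **`a ≠ b ⟹ μ(F) + 2 ≤ min(a, b)`** (`a = ord₂ F(0)`, `b = ord₂ F(−2)`), for non-zero `F ∈ ℤ₂⟦T⟧` with `ι`-stable ideal
vanishing at neither `ι`-fixed point. [cite: GreenbergLNM1716, Thm. 1.14 and §4 p. 107] [cite: MazurTateTeitelbaum1986Invent, Ch. I §17] -/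
theorem mu_add_two_le_of_ne {F : IwasawaAlgebra 2} (hF0 : F ≠ 0) (hι : ∃ u : (IwasawaAlgebra 2)ˣ, invol 2 F = u * F)
    (h0 : constantCoeff F ≠ 0) (h2 : evalAt (-2 : ℤ_[2]) F ≠ 0)
    (hne : (constantCoeff F).valuation ≠ (evalAt (-2 : ℤ_[2]) F).valuation) :
    mu F + 2 ≤ (constantCoeff F).valuation ∧ mu F + 2 ≤ (evalAt (-2 : ℤ_[2]) F).valuation := by
  rcases twinValue_dichotomy _ F hF0 le_rfl hι h0 h2 with h | h
  · exact absurd h hne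
  · exact h

/-- ★★★ **THE TWIN-VALUE LEMMA**: for non-zero `F ∈ ℤ₂⟦T⟧` with `ι`-stable ideal, if ONE of `ord₂ F(0)`, `ord₂ F(−2)` equals
`2` and the other does not (both values non-zero), then **`μ(F) = 0`**. [cite: GreenbergLNM1716, Thm. 1.14 and §4 p. 107]
[cite: MazurTateTeitelbaum1986Invent, Ch. I §17] [cite: Washington1997, §7.1] -/
theorem mu_eq_zero_of_two_eq_of_ne {F : IwasawaAlgebra 2} (hF0 : F ≠ 0) (hι : ∃ u : (IwasawaAlgebra 2)ˣ, invol 2 F = u * F)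
    (h0 : constantCoeff F ≠ 0) (h2 : evalAt (-2 : ℤ_[2]) F ≠ 0)
    (hmin : (constantCoeff F).valuation = 2 ∨ (evalAt (-2 : ℤ_[2]) F).valuation = 2)
    (hne : (constantCoeff F).valuation ≠ (evalAt (-2 : ℤ_[2]) F).valuation) : mu F = 0 := by
  obtain ⟨ha, hb⟩ := mu_add_two_le_of_ne hF0 hι h0 h2 hne
  rcases hmin with h | h <;> omega

/-- ★★★ **THE TWIN-VALUE LEMMA, `a = 2 < b` form**: `ord₂ F(0) = 2` and `3 ≤ ord₂ F(−2)` (`F(−2) ≠ 0`) ⟹ `μ(F) = 0`.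
[cite: GreenbergLNM1716, Thm. 1.14 and §4 p. 107] [cite: MazurTateTeitelbaum1986Invent, Ch. I §17] -/
theorem mu_eq_zero_of_valuation_constantCoeff_eq_two {F : IwasawaAlgebra 2} (hF0 : F ≠ 0)
    (hι : ∃ u : (IwasawaAlgebra 2)ˣ, invol 2 F = u * F) (h0 : constantCoeff F ≠ 0) (h2 : evalAt (-2 : ℤ_[2]) F ≠ 0)
    (ha : (constantCoeff F).valuation = 2) (hb : 3 ≤ (evalAt (-2 : ℤ_[2]) F).valuation) : mu F = 0 :=
  mu_eq_zero_of_two_eq_of_ne hF0 hι h0 h2 (Or.inl ha) (by omega)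

/-- ★★★ **THE TWIN-VALUE LEMMA, `b = 2 < a` form**: `ord₂ F(−2) = 2` and `3 ≤ ord₂ F(0)` (`F(0) ≠ 0`) ⟹ `μ(F) = 0` — the
form that serves the weight-`4` (`a₂ = −1`, `#Ẽ(𝔽₂) = 4`) anchors. [cite: GreenbergLNM1716, Thm. 1.14 and §4 p. 107]
[cite: MazurTateTeitelbaum1986Invent, Ch. I §17] -/
theorem mu_eq_zero_of_valuation_evalAt_eq_two {F : IwasawaAlgebra 2} (hF0 : F ≠ 0)
    (hι : ∃ u : (IwasawaAlgebra 2)ˣ, invol 2 F = u * F) (h0 : constantCoeff F ≠ 0) (h2 : evalAt (-2 : ℤ_[2]) F ≠ 0)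
    (hb : (evalAt (-2 : ℤ_[2]) F).valuation = 2) (ha : 3 ≤ (constantCoeff F).valuation) : mu F = 0 :=
  mu_eq_zero_of_two_eq_of_ne hF0 hι h0 h2 (Or.inr hb) (by omega)

end Dichotomy

end Summit.BirchSwinnertonDyer.BirchSwinnertonDyer.Theorems.AlignedTransportAtTwoTwinValueAlgebra

end
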